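import Summits.ResolutionOfSingularities.ResolutionOfSingularities.Theorems.ConeExit.Negative.Mirror

/-!
# `ConeExit` (crux stmt-ResolutionOfSingularities-16883, route `WildCones`): the two hypotheses on
# the SUCCESSOR are load-bearing — neither `Isol (step i τ c)` nor `MultP (step i τ c)` can be
# dropped (negative-side support, refuter cdisprove seat; this file refutes nothing stated in the
# route — `ConeExit` carries both)

`ConeExit`: `Isol c → MultP c → Isol (step i τ c) → MultP (step i τ c) → OrdP c ∧ dL c = 1` over the
point-blow-up calculus of `zᵖ = a(u₁ … uₙ)` (exact mirror `Negative/Mirror.lean`, `crux_iff`). The two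
hypotheses on the START are decorative (the proof sketch uses neither `Isol c` nor — given `n ≥ 3` —
`MultP c`); the two hypotheses on the SUCCESSOR carry the statement. This file records the latter
through the formal calculus, sorry-free, with ONE start `fermat3 = u₁⁴ + u₂⁷ + u₃⁷` over `𝔽₃`
(`p = 3`, `n = 3`; isolated: `(∂a) = (u₁³, u₂⁶, u₃⁶)`; multiplicity `3`; cleaned order `4`, so the
conclusion `OrdP c` FAILS) and two of its charts at translation `0`:

* chart `u₂`: `step` gives `u₁⁴u₂ + u₂⁴ + u₂⁴u₃⁷` (`step_fermat3_chart1`), of multiplicity `3` — so the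
  body of `crux_iff` with `Isol (step i τ c)` deleted is false (`coneExit_false_without_isolStep`; this
  successor is singular along the `u₃`-axis, as Case A predicts, but that is not needed here);
* chart `u₁`: `step` gives `u₁ + u₁⁴u₂⁷ + u₁⁴u₃⁷` (`step_fermat3_chart0`), whose `∂₁` has constant term
  `1`, a unit of `𝔽₃[[u]]`, so `(∂a') = (1)` and the successor is (trivially) isolated — so the body of
  `crux_iff` with `MultP (step i τ c)` deleted is false (`coneExit_false_without_multPStep`; this
  successor is a smooth point, multiplicity `1 < 3`).

Isolatedness certificates use `module_finite_quotient_of_X_pow_mem` (`Mirror.lean`).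
-/

noncomputable section

-- single-problem summit: the doubled namespace component `ResolutionOfSingularities` is forced by the tree layout
set_option linter.dupNamespace false

namespace Summit.ResolutionOfSingularities.ResolutionOfSingularities.Theorems.ConeExit.Negative

open scoped BigOperators Classical
open MvPowerSeries

/-! ## The start `u₁⁴ + u₂⁷ + u₃⁷` over `𝔽₃` -/

/-- The start `a = u₁⁴ + u₂⁷ + u₃⁷` over `𝔽₃` (`u_{j+1} ↔ j`), cleaned order `4 = p + 1`, as a coefficient
function. [folklore] -/
def fermat3 : (Fin 3 → ℕ) → ZMod 3 :=
  fun A =>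
    if A 0 = 4 ∧ A 1 = 0 ∧ A 2 = 0 then 1
    else if A 0 = 0 ∧ A 1 = 7 ∧ A 2 = 0 then 1
    else if A 0 = 0 ∧ A 1 = 0 ∧ A 2 = 7 then 1
    else 0

/-- Support of `fermat3`. [folklore] -/
lemma fermat3_ne_zero_iff (A : Fin 3 → ℕ) :
    fermat3 A ≠ 0 ↔
      (A 0 = 4 ∧ A 1 = 0 ∧ A 2 = 0) ∨ (A 0 = 0 ∧ A 1 = 7 ∧ A 2 = 0) ∨ (A 0 = 0 ∧ A 1 = 0 ∧ A 2 = 7) := by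
  constructor
  · intro h
    unfold fermat3 at h
    split_ifs at h with h1 h2 h3
    · exact Or.inl h1
    · exact Or.inr (Or.inl h2)
    · exact Or.inr (Or.inr h3)
    · exact absurd rfl h
  · intro h
    unfold fermat3
    split_ifs <;> first | decide | (exfalso; omega)

/-- `fermat3` is `3`-clean. [folklore] -/
lemma clean_fermat3 : clean 3 fermat3 = fermat3 := by
  funext A
  unfold clean
  split_ifs with h
  · symm
    by_contra hne
    rcases (fermat3_ne_zero_iff A).mp hne with hA | hA | hA
    · have := h 0; omega
    · have := h 1; omega
    · have := h 2; omega
  · rfl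

/-- The order of `fermat3` is at least `3` (it is `4`). [folklore] -/
lemma three_le_ord_fermat3 : 3 ≤ ord fermat3 := by
  unfold ord
  apply le_csInf
  · refine ⟨4, ![4, 0, 0], (fermat3_ne_zero_iff _).mpr (Or.inl (by simp)), ?_⟩
    simp [Fin.sum_univ_three]
  · rintro m ⟨A, hA, rfl⟩
    rw [Fin.sum_univ_three]
    rcases (fermat3_ne_zero_iff A).mp hA with h | h | h <;> omega

/-- `fermat3` has multiplicity `3`. [folklore] -/
lemma multP_fermat3 : (∃ A, clean 3 fermat3 A ≠ 0) ∧
    ∀ A, clean 3 fermat3 A ≠ 0 → 3 ≤ Finset.sum Finset.univ (fun j => A j) := by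
  rw [clean_fermat3]
  refine ⟨⟨![4, 0, 0], (fermat3_ne_zero_iff _).mpr (Or.inl (by simp))⟩, ?_⟩
  intro A hA
  rw [Fin.sum_univ_three]
  rcases (fermat3_ne_zero_iff A).mp hA with h | h | h <;> omega

/-- `fermat3` does NOT have cleaned order exactly `3`. [folklore] -/
lemma not_ordP_fermat3 :
    ¬ ∃ A, clean 3 fermat3 A ≠ 0 ∧ Finset.sum Finset.univ (fun j => A j) = 3 := by
  rw [clean_fermat3]
  rintro ⟨A, hA, hs⟩
  rw [Fin.sum_univ_three] at hs
  rcases (fermat3_ne_zero_iff A).mp hA with h | h | h <;> omega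

/-- Exponent vectors of `Fin 3 →₀ ℕ` by coordinates. [folklore] -/
lemma finsupp3_eq_iff (A : Fin 3 →₀ ℕ) (a b c : ℕ) :
    A = Finsupp.single (0 : Fin 3) a + Finsupp.single (1 : Fin 3) b + Finsupp.single (2 : Fin 3) c ↔
      A 0 = a ∧ A 1 = b ∧ A 2 = c := by
  constructor
  · intro h; subst h; simp
  · rintro ⟨h0, h1, h2⟩; ext j; fin_cases j <;> simp [h0, h1, h2]

/-- `∂₁(u₁⁴ + u₂⁷ + u₃⁷) = u₁³` over `𝔽₃`. [folklore] -/
lemma pd0_fermat3 : pd 0 (ser 3 fermat3) = (X 0 : MvPowerSeries (Fin 3) (ZMod 3)) ^ 3 := by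
  ext A
  rw [coeff_pd_ser, coeff_ser, clean_fermat3, coeff_X_pow]
  have e0 : (A + Finsupp.single (0 : Fin 3) 1 : Fin 3 →₀ ℕ) 0 = A 0 + 1 := by simp
  have e1 : (A + Finsupp.single (0 : Fin 3) 1 : Fin 3 →₀ ℕ) 1 = A 1 := by simp
  have e2 : (A + Finsupp.single (0 : Fin 3) 1 : Fin 3 →₀ ℕ) 2 = A 2 := by simp
  have hT : A = Finsupp.single (0 : Fin 3) 3 ↔ A 0 = 3 ∧ A 1 = 0 ∧ A 2 = 0 := by
    simpa using finsupp3_eq_iff A 3 0 0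
  unfold fermat3
  simp only [e0, e1, e2]
  by_cases hc : A 0 = 3 ∧ A 1 = 0 ∧ A 2 = 0
  · rw [if_pos (hT.mpr hc), if_pos (show A 0 + 1 = 4 ∧ A 1 = 0 ∧ A 2 = 0 by omega), hc.1]; decide
  · rw [if_neg (fun h' => hc (hT.mp h')), if_neg (show ¬ (A 0 + 1 = 4 ∧ A 1 = 0 ∧ A 2 = 0) by omega),
      if_neg (show ¬ (A 0 + 1 = 0 ∧ A 1 = 7 ∧ A 2 = 0) by omega),
      if_neg (show ¬ (A 0 + 1 = 0 ∧ A 1 = 0 ∧ A 2 = 7) by omega), mul_zero]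

/-- `∂₂(u₁⁴ + u₂⁷ + u₃⁷) = u₂⁶` over `𝔽₃`. [folklore] -/
lemma pd1_fermat3 : pd 1 (ser 3 fermat3) = (X 1 : MvPowerSeries (Fin 3) (ZMod 3)) ^ 6 := by
  ext A
  rw [coeff_pd_ser, coeff_ser, clean_fermat3, coeff_X_pow]
  have e0 : (A + Finsupp.single (1 : Fin 3) 1 : Fin 3 →₀ ℕ) 0 = A 0 := by simp
  have e1 : (A + Finsupp.single (1 : Fin 3) 1 : Fin 3 →₀ ℕ) 1 = A 1 + 1 := by simp
  have e2 : (A + Finsupp.single (1 : Fin 3) 1 : Fin 3 →₀ ℕ) 2 = A 2 := by simp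
  have hT : A = Finsupp.single (1 : Fin 3) 6 ↔ A 0 = 0 ∧ A 1 = 6 ∧ A 2 = 0 := by
    simpa using finsupp3_eq_iff A 0 6 0
  unfold fermat3
  simp only [e0, e1, e2]
  by_cases hc : A 0 = 0 ∧ A 1 = 6 ∧ A 2 = 0
  · rw [if_pos (hT.mpr hc), if_neg (show ¬ (A 0 = 4 ∧ A 1 + 1 = 0 ∧ A 2 = 0) by omega),
      if_pos (show A 0 = 0 ∧ A 1 + 1 = 7 ∧ A 2 = 0 by omega), hc.2.1]; decide
  · rw [if_neg (fun h' => hc (hT.mp h')), if_neg (show ¬ (A 0 = 4 ∧ A 1 + 1 = 0 ∧ A 2 = 0) by omega),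
      if_neg (show ¬ (A 0 = 0 ∧ A 1 + 1 = 7 ∧ A 2 = 0) by omega),
      if_neg (show ¬ (A 0 = 0 ∧ A 1 + 1 = 0 ∧ A 2 = 7) by omega), mul_zero]

/-- `∂₃(u₁⁴ + u₂⁷ + u₃⁷) = u₃⁶` over `𝔽₃`. [folklore] -/
lemma pd2_fermat3 : pd 2 (ser 3 fermat3) = (X 2 : MvPowerSeries (Fin 3) (ZMod 3)) ^ 6 := by
  ext A
  rw [coeff_pd_ser, coeff_ser, clean_fermat3, coeff_X_pow]
  have e0 : (A + Finsupp.single (2 : Fin 3) 1 : Fin 3 →₀ ℕ) 0 = A 0 := by simp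
  have e1 : (A + Finsupp.single (2 : Fin 3) 1 : Fin 3 →₀ ℕ) 1 = A 1 := by simp
  have e2 : (A + Finsupp.single (2 : Fin 3) 1 : Fin 3 →₀ ℕ) 2 = A 2 + 1 := by simp
  have hT : A = Finsupp.single (2 : Fin 3) 6 ↔ A 0 = 0 ∧ A 1 = 0 ∧ A 2 = 6 := by
    simpa using finsupp3_eq_iff A 0 0 6
  unfold fermat3
  simp only [e0, e1, e2]
  by_cases hc : A 0 = 0 ∧ A 1 = 0 ∧ A 2 = 6
  · rw [if_pos (hT.mpr hc), if_neg (show ¬ (A 0 = 4 ∧ A 1 = 0 ∧ A 2 + 1 = 0) by omega),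
      if_neg (show ¬ (A 0 = 0 ∧ A 1 = 7 ∧ A 2 + 1 = 0) by omega),
      if_pos (show A 0 = 0 ∧ A 1 = 0 ∧ A 2 + 1 = 7 by omega), hc.2.2]; decide
  · rw [if_neg (fun h' => hc (hT.mp h')), if_neg (show ¬ (A 0 = 4 ∧ A 1 = 0 ∧ A 2 + 1 = 0) by omega),
      if_neg (show ¬ (A 0 = 0 ∧ A 1 = 7 ∧ A 2 + 1 = 0) by omega),
      if_neg (show ¬ (A 0 = 0 ∧ A 1 = 0 ∧ A 2 + 1 = 7) by omega), mul_zero]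

/-- **`u₁⁴ + u₂⁷ + u₃⁷` is ISOLATED**: `(∂a) = (u₁³, u₂⁶, u₃⁶)` contains `X_k ^ 6`. [folklore] -/
lemma isol_fermat3 : Module.Finite (ZMod 3) (MvPowerSeries (Fin 3) (ZMod 3) ⧸ jac 3 fermat3) := by
  apply module_finite_quotient_of_X_pow_mem _ 6
  intro k
  fin_cases k
  · show (X 0 : MvPowerSeries (Fin 3) (ZMod 3)) ^ 6 ∈ jac 3 fermat3
    rw [show (X 0 : MvPowerSeries (Fin 3) (ZMod 3)) ^ 6 = X 0 ^ 3 * X 0 ^ 3 from by ring]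
    refine Ideal.mul_mem_left _ _ ?_
    rw [← pd0_fermat3]; exact Ideal.subset_span ⟨0, rfl⟩
  · show (X 1 : MvPowerSeries (Fin 3) (ZMod 3)) ^ 6 ∈ jac 3 fermat3
    rw [← pd1_fermat3]; exact Ideal.subset_span ⟨1, rfl⟩
  · show (X 2 : MvPowerSeries (Fin 3) (ZMod 3)) ^ 6 ∈ jac 3 fermat3
    rw [← pd2_fermat3]; exact Ideal.subset_span ⟨2, rfl⟩

/-! ## Chart `u₂`: the multiplicity-`3` successor `u₁⁴u₂ + u₂⁴ + u₂⁴u₃⁷` -/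

/-- The chart-`u₂` successor `u₁⁴u₂ + u₂⁴ + u₂⁴u₃⁷` of `fermat3` (translation `0`), as a coefficient
function. [folklore] -/
def fermat3b : (Fin 3 → ℕ) → ZMod 3 :=
  fun A =>
    if A 0 = 4 ∧ A 1 = 1 ∧ A 2 = 0 then 1
    else if A 0 = 0 ∧ A 1 = 4 ∧ A 2 = 0 then 1
    else if A 0 = 0 ∧ A 1 = 4 ∧ A 2 = 7 then 1
    else 0

/-- Support of `fermat3b`. [folklore] -/
lemma fermat3b_ne_zero_iff (A : Fin 3 → ℕ) :
    fermat3b A ≠ 0 ↔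
      (A 0 = 4 ∧ A 1 = 1 ∧ A 2 = 0) ∨ (A 0 = 0 ∧ A 1 = 4 ∧ A 2 = 0) ∨ (A 0 = 0 ∧ A 1 = 4 ∧ A 2 = 7) := by
  constructor
  · intro h
    unfold fermat3b at h
    split_ifs at h with h1 h2 h3
    · exact Or.inl h1
    · exact Or.inr (Or.inl h2)
    · exact Or.inr (Or.inr h3)
    · exact absurd rfl h
  · intro h
    unfold fermat3b
    split_ifs <;> first | decide | (exfalso; omega)

/-- `fermat3b` is `3`-clean. [folklore] -/
lemma clean_fermat3b : clean 3 fermat3b = fermat3b := by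
  funext A
  unfold clean
  split_ifs with h
  · symm
    by_contra hne
    rcases (fermat3b_ne_zero_iff A).mp hne with hA | hA | hA
    · have := h 0; omega
    · have := h 1; omega
    · have := h 1; omega
  · rfl

/-- **One step of the dynamics, chart `u₂`, translation `0`**: `u₁⁴ + u₂⁷ + u₃⁷ ↦
(u₂⁴u₁⁴ + u₂⁷ + u₂⁷u₃⁷)/u₂³ = u₁⁴u₂ + u₂⁴ + u₂⁴u₃⁷`, already clean. [folklore] -/
lemma step_fermat3_chart1 : step 3 (1 : Fin 3) (0 : Fin 3 → ZMod 3) fermat3 = fermat3b := by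
  unfold step
  rw [clean_fermat3, if_pos three_le_ord_fermat3, tr_zero]
  funext B
  have hsum : ∀ B : Fin 3 → ℕ,
      Finset.sum (Finset.univ.erase (1 : Fin 3)) (fun j => B j) = B 0 + B 2 := by
    intro B
    have h := Finset.add_sum_erase Finset.univ (fun j => B j) (Finset.mem_univ (1 : Fin 3))
    rw [Fin.sum_univ_three] at h
    omega
  have h01 : (0 : Fin 3) ≠ 1 := by decide
  have h21 : (2 : Fin 3) ≠ 1 := by decide
  have hall : (∀ j : Fin 3, 3 ∣ B j) ↔ 3 ∣ B 0 ∧ 3 ∣ B 1 ∧ 3 ∣ B 2 :=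
    ⟨fun h => ⟨h 0, h 1, h 2⟩, fun h j => by fin_cases j; exacts [h.1, h.2.1, h.2.2]⟩
  unfold clean dv bl fermat3 fermat3b
  simp only [hsum, Function.update_self, Function.update_of_ne h01, Function.update_of_ne h21, hall]
  split_ifs <;> first | rfl | omega

/-- `fermat3b` has multiplicity `3`. [folklore] -/
lemma multP_fermat3b : (∃ A, clean 3 fermat3b A ≠ 0) ∧
    ∀ A, clean 3 fermat3b A ≠ 0 → 3 ≤ Finset.sum Finset.univ (fun j => A j) := by
  rw [clean_fermat3b]
  refine ⟨⟨![4, 1, 0], (fermat3b_ne_zero_iff _).mpr (Or.inl (by simp))⟩, ?_⟩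
  intro A hA
  rw [Fin.sum_univ_three]
  rcases (fermat3b_ne_zero_iff A).mp hA with h | h | h <;> omega

/-! ## Chart `u₁`: the smooth successor `u₁ + u₁⁴u₂⁷ + u₁⁴u₃⁷` -/

/-- The chart-`u₁` successor `u₁ + u₁⁴u₂⁷ + u₁⁴u₃⁷` of `fermat3` (translation `0`), as a coefficient
function. [folklore] -/
def fermat3a : (Fin 3 → ℕ) → ZMod 3 :=
  fun A =>
    if A 0 = 1 ∧ A 1 = 0 ∧ A 2 = 0 then 1
    else if A 0 = 4 ∧ A 1 = 7 ∧ A 2 = 0 then 1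
    else if A 0 = 4 ∧ A 1 = 0 ∧ A 2 = 7 then 1
    else 0

/-- **One step of the dynamics, chart `u₁`, translation `0`**: `u₁⁴ + u₂⁷ + u₃⁷ ↦
(u₁⁴ + u₁⁷u₂⁷ + u₁⁷u₃⁷)/u₁³ = u₁ + u₁⁴u₂⁷ + u₁⁴u₃⁷`, already clean. [folklore] -/
lemma step_fermat3_chart0 : step 3 (0 : Fin 3) (0 : Fin 3 → ZMod 3) fermat3 = fermat3a := by
  unfold step
  rw [clean_fermat3, if_pos three_le_ord_fermat3, tr_zero]
  funext B
  have hsum : ∀ B : Fin 3 → ℕ,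
      Finset.sum (Finset.univ.erase (0 : Fin 3)) (fun j => B j) = B 1 + B 2 := by
    intro B
    have h := Finset.add_sum_erase Finset.univ (fun j => B j) (Finset.mem_univ (0 : Fin 3))
    rw [Fin.sum_univ_three] at h
    omega
  have h10 : (1 : Fin 3) ≠ 0 := by decide
  have h20 : (2 : Fin 3) ≠ 0 := by decide
  have hall : (∀ j : Fin 3, 3 ∣ B j) ↔ 3 ∣ B 0 ∧ 3 ∣ B 1 ∧ 3 ∣ B 2 :=
    ⟨fun h => ⟨h 0, h 1, h 2⟩, fun h j => by fin_cases j; exacts [h.1, h.2.1, h.2.2]⟩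
  unfold clean dv bl fermat3 fermat3a
  simp only [hsum, Function.update_self, Function.update_of_ne h10, Function.update_of_ne h20, hall]
  split_ifs <;> first | rfl | omega

/-- `∂₁` of the chart-`u₁` successor has constant term `1` (the successor contains the monomial `u₁`,
which is not a cube, so survives cleaning). [folklore] -/
lemma constantCoeff_pd0_fermat3a : constantCoeff (pd 0 (ser 3 fermat3a)) = 1 := by
  rw [← coeff_zero_eq_constantCoeff_apply, coeff_pd_ser, coeff_ser, zero_add]
  have hc : clean 3 fermat3a ⇑(Finsupp.single (0 : Fin 3) 1) = 1 := by
    unfold clean fermat3a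
    have h0 : (Finsupp.single (0 : Fin 3) 1 : Fin 3 →₀ ℕ) 0 = 1 := by simp
    have h1 : (Finsupp.single (0 : Fin 3) 1 : Fin 3 →₀ ℕ) 1 = 0 := by simp
    have h2 : (Finsupp.single (0 : Fin 3) 1 : Fin 3 →₀ ℕ) 2 = 0 := by simp
    rw [if_neg (fun h => by have := h 0; rw [h0] at this; omega), if_pos ⟨h0, h1, h2⟩]
  rw [hc, mul_one]
  simp

/-- **The chart-`u₁` successor is (trivially) ISOLATED**: its Jacobian ideal contains the unit
`∂₁ a'`, hence is `(1)`. [folklore] -/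
lemma isol_fermat3a : Module.Finite (ZMod 3) (MvPowerSeries (Fin 3) (ZMod 3) ⧸ jac 3 fermat3a) := by
  have hu : IsUnit (pd 0 (ser 3 fermat3a)) := by
    rw [MvPowerSeries.isUnit_iff_constantCoeff, constantCoeff_pd0_fermat3a]; exact isUnit_one
  have htop : jac 3 fermat3a = ⊤ :=
    Ideal.eq_top_of_isUnit_mem _ (Ideal.subset_span ⟨0, rfl⟩) hu
  apply module_finite_quotient_of_X_pow_mem _ 0
  intro k
  rw [htop]; exact Submodule.mem_top

/-! ## The two negative lemmas -/

/-- **`Isol (step i τ c)` is load-bearing in `ConeExit`.** The negated proposition is the right-hand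
side of `crux_iff` (`Negative/Mirror.lean`) with the hypothesis `Isol (step i τ c)` deleted and
nothing else changed; it is false at `(p, n, κ) = (3, 3, 𝔽₃)`, `c = u₁⁴ + u₂⁷ + u₃⁷` (isolated,
multiplicity `3`, cleaned order `4`), chart `u₂`, `τ = 0`: the successor `u₁⁴u₂ + u₂⁴ + u₂⁴u₃⁷` has
multiplicity `3`, and `OrdP c` fails. (Case A of the crux says exactly that such a successor cannot
ALSO be isolated.) [folklore] -/
theorem coneExit_false_without_isolStep :
    ¬ ∀ p : ℕ, p.Prime → p ≠ 2 → ∀ n : ℕ, 3 ≤ n → ∀ (κ : Type) [Field κ] [CharP κ p] [PerfectField κ]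
        (c : (Fin n → ℕ) → κ) (i : Fin n) (τ : Fin n → κ),
        Module.Finite κ (MvPowerSeries (Fin n) κ ⧸ jac p c) →
        ((∃ A, clean p c A ≠ 0) ∧ ∀ A, clean p c A ≠ 0 → p ≤ Finset.sum Finset.univ (fun j => A j)) →
        ((∃ A, clean p (step p i τ c) A ≠ 0) ∧
          ∀ A, clean p (step p i τ c) A ≠ 0 → p ≤ Finset.sum Finset.univ (fun j => A j)) →
        (∃ A, clean p c A ≠ 0 ∧ Finset.sum Finset.univ (fun j => A j) = p) ∧ dL p c = 1 := by
  intro h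
  have key := h 3 Nat.prime_three (by norm_num) 3 le_rfl (ZMod 3) fermat3 1 0 isol_fermat3
    multP_fermat3 (by rw [step_fermat3_chart1]; exact multP_fermat3b)
  exact not_ordP_fermat3 key.1

/-- **`MultP (step i τ c)` is load-bearing in `ConeExit`.** The negated proposition is the right-hand
side of `crux_iff` (`Negative/Mirror.lean`) with the hypothesis `MultP (step i τ c)` deleted and
nothing else changed; it is false at `(p, n, κ) = (3, 3, 𝔽₃)`, `c = u₁⁴ + u₂⁷ + u₃⁷` (isolated,
multiplicity `3`, cleaned order `4`), chart `u₁`, `τ = 0`: the successor `u₁ + u₁⁴u₂⁷ + u₁⁴u₃⁷` is a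
smooth point (`(∂a') = (1)`, trivially isolated), and `OrdP c` fails. [folklore] -/
theorem coneExit_false_without_multPStep :
    ¬ ∀ p : ℕ, p.Prime → p ≠ 2 → ∀ n : ℕ, 3 ≤ n → ∀ (κ : Type) [Field κ] [CharP κ p] [PerfectField κ]
        (c : (Fin n → ℕ) → κ) (i : Fin n) (τ : Fin n → κ),
        Module.Finite κ (MvPowerSeries (Fin n) κ ⧸ jac p c) →
        ((∃ A, clean p c A ≠ 0) ∧ ∀ A, clean p c A ≠ 0 → p ≤ Finset.sum Finset.univ (fun j => A j)) →
        Module.Finite κ (MvPowerSeries (Fin n) κ ⧸ jac p (step p i τ c)) →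
        (∃ A, clean p c A ≠ 0 ∧ Finset.sum Finset.univ (fun j => A j) = p) ∧ dL p c = 1 := by
  intro h
  have key := h 3 Nat.prime_three (by norm_num) 3 le_rfl (ZMod 3) fermat3 0 0 isol_fermat3
    multP_fermat3 (by rw [step_fermat3_chart0]; exact isol_fermat3a)
  exact not_ordP_fermat3 key.1

end Summit.ResolutionOfSingularities.ResolutionOfSingularities.Theorems.ConeExit.Negative

end
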